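import Literature.Algebra.Homology.DiscreteRepLayerColimitDivisibility
import HarnessLib

/-!
# `Hⁿ_cont(Γ, M)` is finite, of order `≤ B`, when every finite layer `Hⁿ(Γ⧸U, M^U)` has at most `B` elements
# (Serre I §2.2 Prop. 8: `Hⁿ(Γ, M) = lim→ Hⁿ(Γ⧸U, M^U)` — a directed union of images of sets of size `≤ B`)

Topic `Algebra/Homology`; namespace `Literature.Algebra.Homology.DiscreteRep.LayerColimit`.  THEOREMS ONLY
(no definition, no named fact, no `sorry`, no instance; D-0026).  Sequel of `DiscreteRepLayerColimitGroupCohomology`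
(`exists_inflG_eq`, `inflG_stepG`, `stepG_stepG`) and `DiscreteRepLayerColimitDivisibility` (transport along
`Φ : Extⁿ_{C_Γ}(k, X) ≃+ Hⁿ_cont(Γ, X)`).

If for every open normal `U ≤ Γ` every finite subset of `Hⁿ(Γ⧸U, M^U)` has at most `B` elements, then every finite
subset of `Extⁿ_{C_Γ}(k, M)` (resp. of `Hⁿ_cont(Γ, X)`) has at most `B` elements (`finsetCard_ext_le_of_layers`,
`finsetCard_continuousCohomology_le_of_layers`): finitely many classes are inflated from ONE common layer
(directedness: finite intersections of open normal subgroups), injectively.  Hence the limit group is FINITE with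
`Nat.card ≤ B` (`finite_ext_of_layers`, `natCard_ext_le_of_layers`, `finite_continuousCohomology_of_layers`,
`natCard_continuousCohomology_le_of_layers`).

Written for lane «TATE-EPC-TC» of cell `bsd-eis` (crux `GoodLatticeBDPValue`, stmt-BirchSwinnertonDyer-19032; brick B6a
(F1): with `Γ = U ≤ G_{K,S}` open, `M = E_S`, `n = 1` and the layer bound `#H¹(Gal(E/F₀), 𝒪_{E,S}ˣ) ≤ #Cl_S(F₀)` this gives
`H¹(U, E_S)` finite — NSW (8.3.11)(ii) in the weak form needed for the finiteness of `H²(G_S, μ_p)`).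

## References
* J.-P. Serre, *Cohomologie galoisienne* (1994), I §2.2 Prop. 8. [SerreGaloisCohomology1997]
* J. Neukirch, A. Schmidt, K. Wingberg, *Cohomology of Number Fields*, 2nd ed. (2008), (1.5.1), (8.3.11)(ii).
  [NeukirchSchmidtWingberg2008]
-/

noncomputable section

namespace Literature.Algebra.Homology

namespace DiscreteRep

namespace LayerColimit

open CategoryTheory CategoryTheory.Limits CategoryTheory.Abelian

universe u

variable {k Γ : Type u} [CommRing k] [Group Γ] [TopologicalSpace Γ] [IsTopologicalGroup Γ]
  [CompactSpace Γ] [TotallyDisconnectedSpace Γ]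

/-! ### §1 Directedness: finitely many open normal subgroups have a common open normal refinement -/

omit [IsTopologicalGroup Γ] [CompactSpace Γ] [TotallyDisconnectedSpace Γ] in
/-- Finitely many open normal subgroups `U i` (`i ∈ s`) contain a common open normal subgroup.
[cite: SerreGaloisCohomology1997, I §2.2 Prop. 8] -/
theorem exists_openNormalSubgroup_le_of_finset {ι : Type*} (s : Finset ι) (U : ι → OpenNormalSubgroup Γ)
    (U₀ : OpenNormalSubgroup Γ) :
    ∃ W : OpenNormalSubgroup Γ, ∀ i ∈ s, (W : Subgroup Γ) ≤ U i := by
  classical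
  induction s using Finset.induction_on with
  | empty => exact ⟨U₀, fun i hi => absurd hi (Finset.notMem_empty i)⟩
  | insert a s ha ih =>
    obtain ⟨W, hW⟩ := ih
    refine ⟨U a ⊓ W, fun i hi => ?_⟩
    rcases Finset.mem_insert.1 hi with rfl | hi
    · exact fun x hx => (show x ∈ ((U i ⊓ W : OpenNormalSubgroup Γ) : Set Γ) from hx).1
    · exact fun x hx => hW i hi (show x ∈ ((U a ⊓ W : OpenNormalSubgroup Γ) : Set Γ) from hx).2

/-! ### §2 On `Extⁿ_{C_Γ}(k, M)` -/

/-- **Finitely many classes of `Extⁿ_{C_Γ}(k, M)` come injectively from one layer**: if every finite subset of every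
layer `Hⁿ(Γ⧸U, M^U)` has at most `B` elements, so does every finite subset of `Extⁿ_{C_Γ}(k, M)`.
[cite: SerreGaloisCohomology1997, I §2.2 Prop. 8] [cite: NeukirchSchmidtWingberg2008, (1.5.1)] -/
theorem finsetCard_ext_le_of_layers (n : ℕ) (M : DiscreteRepCat k Γ) (B : ℕ)
    (h : ∀ (U : OpenNormalSubgroup Γ)
      (t : Finset (groupCohomology ((invariantsQuotFunctor k (U : Subgroup Γ)).obj M) n)), t.card ≤ B)
    (s : Finset (Ext (triv (Γ := Γ) k) M n)) : s.card ≤ B := by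
  classical
  -- each class is inflated from some layer
  choose U c hc using fun x : Ext (triv (Γ := Γ) k) M n => exists_inflG_eq n M x
  -- a common refinement of the layers of the classes in `s` (the top open normal subgroup as default)
  obtain ⟨W, hW⟩ := exists_openNormalSubgroup_le_of_finset s U
    ⟨⊤, by simp⟩
  -- push the chosen layer classes to the common layer `W`
  let f : {x // x ∈ s} → groupCohomology ((invariantsQuotFunctor k (W : Subgroup Γ)).obj M) n :=
    fun x => stepG (U x.1) W (hW x.1 x.2) M n (c x.1)
  have hf : ∀ x : {x // x ∈ s}, inflG W M n (f x) = x.1 := fun x => by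
    simp only [f, inflG_stepG, hc]
  have hinj : Function.Injective f := fun x y hxy => Subtype.ext (by rw [← hf x, ← hf y, hxy])
  calc s.card = s.attach.card := Finset.card_attach.symm
    _ = (s.attach.image f).card := (Finset.card_image_of_injective _ hinj).symm
    _ ≤ B := h W _

/-- **`Extⁿ_{C_Γ}(k, M)` is finite** when the finite subsets of its layers are uniformly bounded.
[cite: SerreGaloisCohomology1997, I §2.2 Prop. 8] -/
theorem finite_ext_of_layers (n : ℕ) (M : DiscreteRepCat k Γ) (B : ℕ)
    (h : ∀ (U : OpenNormalSubgroup Γ)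
      (t : Finset (groupCohomology ((invariantsQuotFunctor k (U : Subgroup Γ)).obj M) n)), t.card ≤ B) :
    Finite (Ext (triv (Γ := Γ) k) M n) := by
  by_contra hinf
  rw [not_finite_iff_infinite] at hinf
  obtain ⟨s, hs⟩ := Infinite.exists_subset_card_eq (Ext (triv (Γ := Γ) k) M n) (B + 1)
  have := finsetCard_ext_le_of_layers n M B h s
  omega

/-- **`#Extⁿ_{C_Γ}(k, M) ≤ B`** when the finite subsets of its layers have at most `B` elements.
[cite: SerreGaloisCohomology1997, I §2.2 Prop. 8] -/
theorem natCard_ext_le_of_layers (n : ℕ) (M : DiscreteRepCat k Γ) (B : ℕ)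
    (h : ∀ (U : OpenNormalSubgroup Γ)
      (t : Finset (groupCohomology ((invariantsQuotFunctor k (U : Subgroup Γ)).obj M) n)), t.card ≤ B) :
    Nat.card (Ext (triv (Γ := Γ) k) M n) ≤ B := by
  classical
  haveI := finite_ext_of_layers n M B h
  haveI := Fintype.ofFinite (Ext (triv (Γ := Γ) k) M n)
  rw [Nat.card_eq_fintype_card, ← Finset.card_univ]
  exact finsetCard_ext_le_of_layers n M B h _

/-! ### §3 On `Hⁿ_cont(Γ, X)` (Mathlib's continuous cohomology), through `Φ` -/

variable [TopologicalSpace k]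

open TopRep in
/-- **Finitely many classes of `Hⁿ_cont(Γ, X)` come injectively from one layer** (transport of
`finsetCard_ext_le_of_layers` along `Φ : Extⁿ_{C_Γ}(k, X) ≃+ Hⁿ_cont(Γ, X)`).
[cite: SerreGaloisCohomology1997, I §2.2 Prop. 8] [cite: Harari2020, Prop. 4.18, Remark 4.24] -/
theorem finsetCard_continuousCohomology_le_of_layers (X : TopRep.{u} k Γ) [DiscreteTopology X.V]
    (hX : IsDiscrete ((forgetTop k Γ).obj X)) (n B : ℕ)
    (h : ∀ (U : OpenNormalSubgroup Γ)
      (t : Finset (groupCohomology ((invariantsQuotFunctor k (U : Subgroup Γ)).obj (stdBase X hX)) n)),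
      t.card ≤ B)
    (s : Finset (continuousCohomology n X : TopModuleCat.{u} k)) : s.card ≤ B := by
  classical
  let Φ := extTrivAddEquivContinuousCohomology X hX n
  calc s.card = (s.image Φ.symm).card := (Finset.card_image_of_injective _ Φ.symm.injective).symm
    _ ≤ B := finsetCard_ext_le_of_layers n (stdBase X hX) B h _

open TopRep in
/-- **`Hⁿ_cont(Γ, X)` is finite** when the finite subsets of its layers `Hⁿ(Γ⧸U, X^U)` are uniformly bounded.
[cite: SerreGaloisCohomology1997, I §2.2 Prop. 8] [cite: Harari2020, Prop. 4.18, Remark 4.24] -/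
theorem finite_continuousCohomology_of_layers (X : TopRep.{u} k Γ) [DiscreteTopology X.V]
    (hX : IsDiscrete ((forgetTop k Γ).obj X)) (n B : ℕ)
    (h : ∀ (U : OpenNormalSubgroup Γ)
      (t : Finset (groupCohomology ((invariantsQuotFunctor k (U : Subgroup Γ)).obj (stdBase X hX)) n)),
      t.card ≤ B) :
    Finite (continuousCohomology n X : TopModuleCat.{u} k) := by
  by_contra hinf
  rw [not_finite_iff_infinite] at hinf
  obtain ⟨s, hs⟩ := Infinite.exists_subset_card_eq (continuousCohomology n X : TopModuleCat.{u} k) (B + 1)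
  have := finsetCard_continuousCohomology_le_of_layers X hX n B h s
  omega

open TopRep in
/-- **`#Hⁿ_cont(Γ, X) ≤ B`** when the finite subsets of its layers have at most `B` elements.
[cite: SerreGaloisCohomology1997, I §2.2 Prop. 8] [cite: Harari2020, Prop. 4.18, Remark 4.24] -/
theorem natCard_continuousCohomology_le_of_layers (X : TopRep.{u} k Γ) [DiscreteTopology X.V]
    (hX : IsDiscrete ((forgetTop k Γ).obj X)) (n B : ℕ)
    (h : ∀ (U : OpenNormalSubgroup Γ)
      (t : Finset (groupCohomology ((invariantsQuotFunctor k (U : Subgroup Γ)).obj (stdBase X hX)) n)),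
      t.card ≤ B) :
    Nat.card (continuousCohomology n X : TopModuleCat.{u} k) ≤ B := by
  classical
  haveI := finite_continuousCohomology_of_layers X hX n B h
  haveI := Fintype.ofFinite (continuousCohomology n X : TopModuleCat.{u} k)
  rw [Nat.card_eq_fintype_card, ← Finset.card_univ]
  exact finsetCard_continuousCohomology_le_of_layers X hX n B h _

/-- Convenience: a finite layer of order `≤ B` has all its finite subsets of size `≤ B` (the hypothesis shape of
this file from `Finite` + `Nat.card ≤ B`). [cite: SerreGaloisCohomology1997, I §2.2 Prop. 8] -/
theorem finsetCard_le_of_finite_of_natCard_le {α : Type*} [Finite α] {B : ℕ} (hB : Nat.card α ≤ B)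
    (t : Finset α) : t.card ≤ B := by
  classical
  haveI := Fintype.ofFinite α
  rw [Nat.card_eq_fintype_card] at hB
  exact (Finset.card_le_univ t).trans hB

end LayerColimit

end DiscreteRep

end Literature.Algebra.Homology

end
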